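import Mathlib

/-!
# Crux `MustSqueeze` (stmt-NavierStokesRegularity-11610), negative side: the Gaussian vortex

The explicit field behind `mustSqueeze_false_without_H3` (file `Negative/WithoutOseen.lean`):
`wit t x = amp · e^{t/2} · e^{−‖x‖²} · rot x`, `rot x = x₀e₁ − x₁e₀`, `amp = 1/8`, with its
derivative `DW`, pointwise bounds (`‖wit‖ ≤ amp e^{t/2}`, `‖wit‖² ≤ e^t g`, `‖∇wit‖² ≤ 16 e^t g`,
`|⟪DW h, h⟫| ≤ 2‖x‖²g‖h‖²`), the Gaussian mass `IG`, the unit-ball volume `V₁`, the ball/cylinder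
integral bounds and the class constant `Cw = 1 + 17 IG + V₁`.  Pure Mathlib content (no route
declaration is mentioned); extracted from the crux work file `Cruxes/MustSqueeze/Disproof.lean` v7
(cdisprove adversary, D-0016).
-/

noncomputable section

namespace Summit.NavierStokesRegularity.NavierStokesRegularity.Theorems.MustSqueeze.Negative

open MeasureTheory Set Filter Topology


/-- `e₀`. -/
def e0 : (EuclideanSpace ℝ (Fin 3)) := EuclideanSpace.single 0 1
/-- `e₁`. -/
def e1 : (EuclideanSpace ℝ (Fin 3)) := EuclideanSpace.single 1 1

/-- The rotation generator about the `e₂`-axis, `rot x = x₀ e₁ − x₁ e₀` (a bounded linear map). -/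
def rot : (EuclideanSpace ℝ (Fin 3)) →L[ℝ] (EuclideanSpace ℝ (Fin 3)) :=
  (EuclideanSpace.proj (0 : Fin 3) : (EuclideanSpace ℝ (Fin 3)) →L[ℝ] ℝ).smulRight e1 -
    (EuclideanSpace.proj (1 : Fin 3) : (EuclideanSpace ℝ (Fin 3)) →L[ℝ] ℝ).smulRight e0

/-- Unfolding `rot`. -/
theorem rot_apply (x : (EuclideanSpace ℝ (Fin 3))) : rot x = x 0 • e1 - x 1 • e0 := rfl

/-- Coordinates of `rot x`: `(−x₁, x₀, 0)`. -/
theorem rot_coord (x : (EuclideanSpace ℝ (Fin 3))) : rot x 0 = -x 1 ∧ rot x 1 = x 0 ∧ rot x 2 = 0 := by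
  refine ⟨?_, ?_, ?_⟩ <;> simp [rot_apply, e0, e1]

/-- The real inner product of `(EuclideanSpace ℝ (Fin 3))` in coordinates. -/
theorem real_inner_fin_three (x y : (EuclideanSpace ℝ (Fin 3))) : inner ℝ x y = x 0 * y 0 + x 1 * y 1 + x 2 * y 2 := by
  simp [PiLp.inner_apply, Fin.sum_univ_three, mul_comm]

/-- `⟪rot x, x⟫ = 0` (the generator is skew). -/
theorem inner_rot_self (x : (EuclideanSpace ℝ (Fin 3))) : inner ℝ (rot x) x = 0 := by
  rw [real_inner_fin_three, (rot_coord x).1, (rot_coord x).2.1, (rot_coord x).2.2]; ring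

/-- `⟪x, rot x⟫ = 0`. -/
theorem inner_self_rot (x : (EuclideanSpace ℝ (Fin 3))) : inner ℝ x (rot x) = 0 := by
  rw [real_inner_comm, inner_rot_self]

/-- `‖rot x‖ ≤ ‖x‖`. -/
theorem norm_rot_le (x : (EuclideanSpace ℝ (Fin 3))) : ‖rot x‖ ≤ ‖x‖ := by
  have h1 : ‖rot x‖ ^ 2 = x 1 ^ 2 + x 0 ^ 2 := by
    rw [EuclideanSpace.real_norm_sq_eq, Fin.sum_univ_three, (rot_coord x).1, (rot_coord x).2.1,
      (rot_coord x).2.2]; ring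
  have h2 : ‖x‖ ^ 2 = x 0 ^ 2 + x 1 ^ 2 + x 2 ^ 2 := by
    rw [EuclideanSpace.real_norm_sq_eq, Fin.sum_univ_three]
  have h3 : ‖rot x‖ ^ 2 ≤ ‖x‖ ^ 2 := by rw [h1, h2]; nlinarith [sq_nonneg (x 2)]
  exact (pow_le_pow_iff_left₀ (norm_nonneg _) (norm_nonneg _) two_ne_zero).1 h3

/-- `rot e₀ = e₁`. -/
theorem rot_e0 : rot e0 = e1 := by
  rw [rot_apply]; simp [e0, e1]

/-- `e₁ ≠ 0`. -/
theorem e1_ne_zero : e1 ≠ 0 := by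
  intro h
  have : ‖e1‖ = 1 := by simp [e1]
  rw [h, norm_zero] at this
  exact zero_ne_one this

/-- The Gaussian envelope `e^{−‖x‖²}`. -/
def gauss (x : (EuclideanSpace ℝ (Fin 3))) : ℝ := Real.exp (-‖x‖ ^ 2)

/-- The Gaussian is positive. -/
theorem gauss_pos (x : (EuclideanSpace ℝ (Fin 3))) : 0 < gauss x := Real.exp_pos _

/-- The Gaussian is at most `1`. -/
theorem gauss_le_one (x : (EuclideanSpace ℝ (Fin 3))) : gauss x ≤ 1 :=
  Real.exp_le_one_iff.2 (neg_nonpos.2 (sq_nonneg _))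

/-- `2 s e^{−s} ≤ 1` for `s ≥ 0` (from `e^s ≥ 1 + s + s²/2`). -/
theorem two_mul_mul_exp_neg_le_one {s : ℝ} (hs : 0 ≤ s) : 2 * s * Real.exp (-s) ≤ 1 := by
  have h := Real.quadratic_le_exp_of_nonneg hs
  have h2 : 2 * s ≤ Real.exp s := by nlinarith [sq_nonneg (s - 1)]
  rw [Real.exp_neg, mul_inv_le_iff₀ (Real.exp_pos _)]
  linarith

/-- `τ e^{−τ/2} ≤ 1` for `τ ≥ 0` (from `e^{τ/2} ≥ 1 + τ/2 + τ²/8 ≥ τ`). -/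
theorem mul_exp_neg_half_le_one {τ : ℝ} (hτ : 0 ≤ τ) : τ * Real.exp (-τ / 2) ≤ 1 := by
  have h := Real.quadratic_le_exp_of_nonneg (by positivity : 0 ≤ τ / 2)
  have h2 : τ ≤ Real.exp (τ / 2) := by nlinarith [sq_nonneg (τ / 2 - 1)]
  rw [show -τ / 2 = -(τ / 2) by ring, Real.exp_neg, mul_inv_le_iff₀ (Real.exp_pos _)]
  linarith

/-- `√τ · e^{−τ/2} ≤ 1` for `τ ≥ 0` (from `e^{τ} ≥ 1 + τ ≥ τ`). -/
theorem sqrt_mul_exp_neg_half_le_one {τ : ℝ} (hτ : 0 ≤ τ) : Real.sqrt τ * Real.exp (-τ / 2) ≤ 1 := by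
  have h1 : τ * Real.exp (-τ) ≤ 1 := by
    have h := Real.add_one_le_exp τ
    rw [Real.exp_neg, mul_inv_le_iff₀ (Real.exp_pos _)]
    linarith
  have h2 : Real.exp (-τ / 2) = Real.sqrt (Real.exp (-τ)) := by
    rw [show -τ / 2 = -τ / 2 from rfl, ← Real.exp_half]
  rw [h2, ← Real.sqrt_mul hτ]
  calc Real.sqrt (τ * Real.exp (-τ)) ≤ Real.sqrt 1 := Real.sqrt_le_sqrt h1
    _ = 1 := Real.sqrt_one

/-- `2‖x‖² e^{−‖x‖²} ≤ 1`. -/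
theorem two_mul_norm_sq_mul_gauss_le_one (x : (EuclideanSpace ℝ (Fin 3))) : 2 * (‖x‖ ^ 2 * gauss x) ≤ 1 := by
  have := two_mul_mul_exp_neg_le_one (sq_nonneg ‖x‖)
  simpa [gauss, mul_assoc] using this

/-- `‖x‖ e^{−‖x‖²} ≤ 1`. -/
theorem norm_mul_gauss_le_one (x : (EuclideanSpace ℝ (Fin 3))) : ‖x‖ * gauss x ≤ 1 := by
  have h1 : ‖x‖ ≤ ‖x‖ ^ 2 + 1 := by nlinarith [sq_nonneg (‖x‖ - 1 / 2)]
  have h2 : ‖x‖ ^ 2 + 1 ≤ Real.exp (‖x‖ ^ 2) := Real.add_one_le_exp _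
  rw [gauss, Real.exp_neg, mul_inv_le_iff₀ (Real.exp_pos _)]
  linarith

/-- `g² ‖x‖² ≤ g`: the squared witness is dominated by ONE Gaussian. -/
theorem gauss_sq_mul_norm_sq_le (x : (EuclideanSpace ℝ (Fin 3))) : gauss x ^ 2 * ‖x‖ ^ 2 ≤ gauss x := by
  have h := two_mul_norm_sq_mul_gauss_le_one x
  have hg := gauss_pos x
  nlinarith [mul_pos hg hg]

/-- `g² (1 + 2‖x‖²)² ≤ 16 g`: the squared gradient of the witness is dominated by `16` Gaussians
(`(1+2s)² ≤ (4+2s)² = 16(1+s/2)² ≤ 16 e^{s}`). -/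
theorem gauss_sq_mul_poly_le (x : (EuclideanSpace ℝ (Fin 3))) : gauss x ^ 2 * (1 + 2 * ‖x‖ ^ 2) ^ 2 ≤ 16 * gauss x := by
  set s : ℝ := ‖x‖ ^ 2 with hs
  have hs0 : 0 ≤ s := sq_nonneg _
  have h1 : s / 2 + 1 ≤ Real.exp (s / 2) := Real.add_one_le_exp _
  have h2 : (s / 2 + 1) ^ 2 ≤ Real.exp (s / 2) ^ 2 := pow_le_pow_left₀ (by positivity) h1 2
  have h3 : Real.exp (s / 2) ^ 2 = Real.exp s := by rw [sq, ← Real.exp_add]; ring_nf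
  have h4 : (1 + 2 * s) ^ 2 ≤ 16 * Real.exp s := by nlinarith
  have hg : gauss x * Real.exp s = 1 := by rw [gauss, ← hs, Real.exp_neg, inv_mul_cancel₀ (Real.exp_pos _).ne']
  have hgp := gauss_pos x
  calc gauss x ^ 2 * (1 + 2 * s) ^ 2 ≤ gauss x ^ 2 * (16 * Real.exp s) := by gcongr
    _ = 16 * gauss x * (gauss x * Real.exp s) := by ring
    _ = 16 * gauss x := by rw [hg, mul_one]

/-- The Gaussian is integrable on `(EuclideanSpace ℝ (Fin 3))` (Mathlib's `∫ e^{−b‖v‖²} = (π/b)^{n/2} ≠ 0`). -/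
theorem integrable_gauss : Integrable gauss := by
  have h := GaussianFourier.integral_rexp_neg_mul_sq_norm (V := (EuclideanSpace ℝ (Fin 3))) (b := 1) one_pos
  have hne : ∫ v : (EuclideanSpace ℝ (Fin 3)), Real.exp (-1 * ‖v‖ ^ 2) ≠ 0 := by
    rw [h]; positivity
  have hi : Integrable (fun v : (EuclideanSpace ℝ (Fin 3)) => Real.exp (-1 * ‖v‖ ^ 2)) := Integrable.of_integral_ne_zero hne
  refine hi.congr (Filter.Eventually.of_forall fun v => ?_)
  simp [gauss]

/-- `IG = ∫ e^{−‖x‖²} dx` (`= π^{3/2}`, value not needed). -/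
def IG : ℝ := ∫ x, gauss x

/-- `0 ≤ IG`. -/
theorem IG_nonneg : 0 ≤ IG := integral_nonneg fun x => (gauss_pos x).le

/-- `V₁ = |B₁|`, the volume of the unit ball of `(EuclideanSpace ℝ (Fin 3))` (`= 4π/3`, value not needed). -/
def V1 : ℝ := (volume (Metric.ball (0 : (EuclideanSpace ℝ (Fin 3))) 1)).toReal

/-- `0 ≤ V₁`. -/
theorem V1_nonneg : 0 ≤ V1 := ENNReal.toReal_nonneg

/-- Scaling of Euclidean balls: `|B_r(x₀)| = r³ |B₁|`. -/
theorem volume_ball_toReal (x₀ : (EuclideanSpace ℝ (Fin 3))) {r : ℝ} (hr : 0 < r) :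
    (volume (Metric.ball x₀ r)).toReal = r ^ 3 * V1 := by
  rw [Measure.addHaar_ball_of_pos volume x₀ hr, ENNReal.toReal_mul, finrank_euclideanSpace_fin,
    ENNReal.toReal_ofReal (by positivity), V1]

/-- The vortex `w(x) = e^{−‖x‖²} rot x`. -/
def vortexW (x : (EuclideanSpace ℝ (Fin 3))) : (EuclideanSpace ℝ (Fin 3)) := gauss x • rot x

/-- Its Fréchet derivative `Dw(x) h = g(x) rot h − 2 g(x) ⟪x, h⟫ rot x`. -/
def DW (x : (EuclideanSpace ℝ (Fin 3))) : (EuclideanSpace ℝ (Fin 3)) →L[ℝ] (EuclideanSpace ℝ (Fin 3)) :=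
  gauss x • rot + ((gauss x * (-2 : ℝ)) • innerSL ℝ x).smulRight (rot x)

/-- Derivative of the Gaussian: `Dg(x) h = −2 g(x) ⟪x, h⟫`. -/
theorem hasFDerivAt_gauss (x : (EuclideanSpace ℝ (Fin 3))) : HasFDerivAt gauss ((gauss x * (-2 : ℝ)) • innerSL ℝ x) x := by
  have h1 : HasFDerivAt (fun x : (EuclideanSpace ℝ (Fin 3)) => -‖x‖ ^ 2) (-(2 • innerSL ℝ x)) x :=
    (hasStrictFDerivAt_norm_sq x).hasFDerivAt.neg
  have h2 := (Real.hasDerivAt_exp (-‖x‖ ^ 2)).comp_hasFDerivAt x h1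
  have h3 : Real.exp (-‖x‖ ^ 2) • -(2 • innerSL ℝ x) = (gauss x * (-2 : ℝ)) • innerSL ℝ x := by
    ext h
    simp [gauss]
    ring
  exact h2.congr_fderiv h3

/-- The vortex has derivative `DW`. -/
theorem hasFDerivAt_vortexW (x : (EuclideanSpace ℝ (Fin 3))) : HasFDerivAt vortexW (DW x) x := by
  have h := (hasFDerivAt_gauss x).smul (rot.hasFDerivAt (x := x))
  exact h

/-- Unfolding `DW`. -/
theorem DW_apply (x h : (EuclideanSpace ℝ (Fin 3))) :
    DW x h = gauss x • rot h + (gauss x * (-2) * inner ℝ x h) • rot x := by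
  simp only [DW, add_apply, FunLike.coe_smul, Pi.smul_apply,
    ContinuousLinearMap.smulRight_apply, innerSL_apply_apply, smul_eq_mul]

/-- The quadratic form of `DW x`: `⟪DW x h, h⟫ = −2 g ⟪x,h⟫⟪rot x, h⟫` (the `g·rot` part is skew). -/
theorem inner_DW_apply_self (x h : (EuclideanSpace ℝ (Fin 3))) :
    inner ℝ (DW x h) h = gauss x * (-2) * inner ℝ x h * inner ℝ (rot x) h := by
  rw [DW_apply, inner_add_left, real_inner_smul_left, real_inner_smul_left, inner_rot_self, mul_zero,
    zero_add]

/-- `|⟪DW x h, h⟫| ≤ 2‖x‖² g(x) ‖h‖²`. -/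
theorem abs_inner_DW_apply_self_le (x h : (EuclideanSpace ℝ (Fin 3))) :
    |inner ℝ (DW x h) h| ≤ 2 * (‖x‖ ^ 2 * gauss x) * ‖h‖ ^ 2 := by
  rw [inner_DW_apply_self]
  have hg := gauss_pos x
  have h1 : |inner ℝ x h| ≤ ‖x‖ * ‖h‖ := abs_real_inner_le_norm x h
  have h2 : |inner ℝ (rot x) h| ≤ ‖x‖ * ‖h‖ :=
    (abs_real_inner_le_norm _ _).trans (mul_le_mul_of_nonneg_right (norm_rot_le x) (norm_nonneg _))
  have key : |inner ℝ x h| * |inner ℝ (rot x) h| ≤ (‖x‖ * ‖h‖) * (‖x‖ * ‖h‖) :=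
    mul_le_mul h1 h2 (abs_nonneg _) (by positivity)
  calc |gauss x * -2 * inner ℝ x h * inner ℝ (rot x) h|
      = 2 * gauss x * (|inner ℝ x h| * |inner ℝ (rot x) h|) := by
        rw [abs_mul, abs_mul, abs_mul, abs_of_pos hg]; norm_num; ring
    _ ≤ 2 * gauss x * ((‖x‖ * ‖h‖) * (‖x‖ * ‖h‖)) := by gcongr
    _ = 2 * (‖x‖ ^ 2 * gauss x) * ‖h‖ ^ 2 := by ring

/-- Operator-norm bound `‖DW x‖ ≤ g(x)(1 + 2‖x‖²)`. -/
theorem norm_DW_le (x : (EuclideanSpace ℝ (Fin 3))) : ‖DW x‖ ≤ gauss x * (1 + 2 * ‖x‖ ^ 2) := by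
  have hg := gauss_pos x
  refine ContinuousLinearMap.opNorm_le_bound _ (by positivity) fun h => ?_
  rw [DW_apply]
  calc ‖gauss x • rot h + (gauss x * -2 * inner ℝ x h) • rot x‖
      ≤ ‖gauss x • rot h‖ + ‖(gauss x * -2 * inner ℝ x h) • rot x‖ := norm_add_le _ _
    _ = gauss x * ‖rot h‖ + 2 * gauss x * |inner ℝ x h| * ‖rot x‖ := by
        rw [norm_smul, norm_smul, Real.norm_eq_abs, Real.norm_eq_abs, abs_of_pos hg, abs_mul, abs_mul,
          abs_of_pos hg, abs_neg, abs_two]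
        ring
    _ ≤ gauss x * ‖h‖ + 2 * gauss x * (‖x‖ * ‖h‖) * ‖x‖ := by
        gcongr
        · exact norm_rot_le h
        · exact abs_real_inner_le_norm x h
        · exact norm_rot_le x
    _ = gauss x * (1 + 2 * ‖x‖ ^ 2) * ‖h‖ := by ring

/-- The amplitude `1/8` (any `a ≤ 1/8` would do for H6 with threshold `1/8`). -/
def amp : ℝ := 1 / 8

/-- `0 < amp`. -/
theorem amp_pos : 0 < amp := by norm_num [amp]

/-- `amp ≤ 1`. -/
theorem amp_le_one : amp ≤ 1 := by norm_num [amp]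

/-- **The drop-H3 witness**: `wit t x = amp · e^{t/2} · e^{−‖x‖²} · rot x`. -/
def wit (t : ℝ) (x : (EuclideanSpace ℝ (Fin 3))) : (EuclideanSpace ℝ (Fin 3)) := (amp * Real.exp (t / 2)) • vortexW x

/-- Derivative of a time slice of the witness. -/
theorem hasFDerivAt_wit (t : ℝ) (x : (EuclideanSpace ℝ (Fin 3))) :
    HasFDerivAt (wit t) ((amp * Real.exp (t / 2)) • DW x) x :=
  (hasFDerivAt_vortexW x).const_smul (amp * Real.exp (t / 2))

/-- `fderiv` of a time slice of the witness. -/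
theorem fderiv_wit (t : ℝ) (x : (EuclideanSpace ℝ (Fin 3))) : fderiv ℝ (wit t) x = (amp * Real.exp (t / 2)) • DW x :=
  (hasFDerivAt_wit t x).fderiv

/-- The time coefficient `amp e^{t/2}` is positive. -/
theorem coef_pos (t : ℝ) : 0 < amp * Real.exp (t / 2) := mul_pos amp_pos (Real.exp_pos _)

/-- Pointwise size: `‖wit t x‖ ≤ amp · e^{t/2}` and `‖wit t x‖² ≤ amp² e^{t} g(x) ≤ g(x)`. -/
theorem norm_wit_le (t : ℝ) (x : (EuclideanSpace ℝ (Fin 3))) : ‖wit t x‖ ≤ amp * Real.exp (t / 2) := by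
  rw [wit, norm_smul, Real.norm_eq_abs, abs_of_pos (coef_pos t), vortexW, norm_smul, Real.norm_eq_abs,
    abs_of_pos (gauss_pos x)]
  have h : gauss x * ‖rot x‖ ≤ 1 := by
    calc gauss x * ‖rot x‖ ≤ gauss x * ‖x‖ := by gcongr; exacts [(gauss_pos x).le, norm_rot_le x]
      _ = ‖x‖ * gauss x := mul_comm _ _
      _ ≤ 1 := norm_mul_gauss_le_one x
  calc amp * Real.exp (t / 2) * (gauss x * ‖rot x‖) ≤ amp * Real.exp (t / 2) * 1 := by
        gcongr; exact (coef_pos t).le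
    _ = amp * Real.exp (t / 2) := mul_one _

/-- `‖wit t x‖² ≤ e^{t} g(x)`. -/
theorem norm_wit_sq_le (t : ℝ) (x : (EuclideanSpace ℝ (Fin 3))) : ‖wit t x‖ ^ 2 ≤ Real.exp t * gauss x := by
  rw [wit, norm_smul, Real.norm_eq_abs, abs_of_pos (coef_pos t), vortexW, norm_smul, Real.norm_eq_abs,
    abs_of_pos (gauss_pos x)]
  have h1 : (gauss x * ‖rot x‖) ^ 2 ≤ gauss x := by
    calc (gauss x * ‖rot x‖) ^ 2 = gauss x ^ 2 * ‖rot x‖ ^ 2 := by ring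
      _ ≤ gauss x ^ 2 * ‖x‖ ^ 2 := by
          gcongr; exact norm_rot_le x
      _ ≤ gauss x := gauss_sq_mul_norm_sq_le x
  have h2 : (amp * Real.exp (t / 2)) ^ 2 ≤ Real.exp t := by
    have : Real.exp (t / 2) ^ 2 = Real.exp t := by rw [sq, ← Real.exp_add]; ring_nf
    calc (amp * Real.exp (t / 2)) ^ 2 = amp ^ 2 * Real.exp (t / 2) ^ 2 := by ring
      _ ≤ 1 * Real.exp (t / 2) ^ 2 := by
          gcongr; · nlinarith [amp_pos, amp_le_one]
      _ = Real.exp t := by rw [one_mul, this]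
  calc (amp * Real.exp (t / 2) * (gauss x * ‖rot x‖)) ^ 2
      = (amp * Real.exp (t / 2)) ^ 2 * (gauss x * ‖rot x‖) ^ 2 := by ring
    _ ≤ Real.exp t * gauss x := mul_le_mul h2 h1 (by positivity) (Real.exp_pos t).le

/-- `‖∇wit t x‖² ≤ 16 e^{t} g(x)`. -/
theorem norm_fderiv_wit_sq_le (t : ℝ) (x : (EuclideanSpace ℝ (Fin 3))) :
    ‖fderiv ℝ (wit t) x‖ ^ 2 ≤ Real.exp t * (16 * gauss x) := by
  rw [fderiv_wit, norm_smul, Real.norm_eq_abs, abs_of_pos (coef_pos t)]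
  have h1 : ‖DW x‖ ^ 2 ≤ 16 * gauss x := by
    calc ‖DW x‖ ^ 2 ≤ (gauss x * (1 + 2 * ‖x‖ ^ 2)) ^ 2 :=
          pow_le_pow_left₀ (norm_nonneg _) (norm_DW_le x) 2
      _ = gauss x ^ 2 * (1 + 2 * ‖x‖ ^ 2) ^ 2 := by ring
      _ ≤ 16 * gauss x := gauss_sq_mul_poly_le x
  have h2 : (amp * Real.exp (t / 2)) ^ 2 ≤ Real.exp t := by
    have : Real.exp (t / 2) ^ 2 = Real.exp t := by rw [sq, ← Real.exp_add]; ring_nf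
    calc (amp * Real.exp (t / 2)) ^ 2 = amp ^ 2 * Real.exp (t / 2) ^ 2 := by ring
      _ ≤ 1 * Real.exp (t / 2) ^ 2 := by
          gcongr; · nlinarith [amp_pos, amp_le_one]
      _ = Real.exp t := by rw [one_mul, this]
  calc (amp * Real.exp (t / 2) * ‖DW x‖) ^ 2 = (amp * Real.exp (t / 2)) ^ 2 * ‖DW x‖ ^ 2 := by ring
    _ ≤ Real.exp t * (16 * gauss x) := mul_le_mul h2 h1 (by positivity) (Real.exp_pos t).le

/-- The explicit class constant of the witness. -/
def Cw : ℝ := 1 + 17 * IG + V1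

/-- `1 ≤ Cw`. -/
theorem one_le_Cw : 1 ≤ Cw := by
  have := IG_nonneg; have := V1_nonneg; rw [Cw]; nlinarith

/-- Slice energy on a ball, large-ball bound: `∫_B ‖wit t‖² ≤ e^{t} IG`. -/
theorem setIntegral_norm_wit_sq_le (t : ℝ) (x₀ : (EuclideanSpace ℝ (Fin 3))) (r : ℝ) :
    ∫ x in Metric.ball x₀ r, ‖wit t x‖ ^ 2 ≤ Real.exp t * IG := by
  have hi : Integrable (fun x => Real.exp t * gauss x) := integrable_gauss.const_mul _
  calc ∫ x in Metric.ball x₀ r, ‖wit t x‖ ^ 2 ≤ ∫ x in Metric.ball x₀ r, Real.exp t * gauss x := by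
        refine integral_mono_of_nonneg (Filter.Eventually.of_forall fun x => by positivity) hi.integrableOn
          (Filter.Eventually.of_forall fun x => norm_wit_sq_le t x)
    _ ≤ ∫ x, Real.exp t * gauss x :=
        setIntegral_le_integral hi (Filter.Eventually.of_forall fun x => by
          have := gauss_pos x; positivity)
    _ = Real.exp t * IG := by rw [integral_const_mul, IG]

/-- Slice energy on a ball, small-ball bound: `∫_B ‖wit t‖² ≤ r³ V₁` for `t ≤ 0`. -/
theorem setIntegral_norm_wit_sq_le' {t : ℝ} (ht : t ≤ 0) (x₀ : (EuclideanSpace ℝ (Fin 3))) {r : ℝ} (hr : 0 < r) :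
    ∫ x in Metric.ball x₀ r, ‖wit t x‖ ^ 2 ≤ r ^ 3 * V1 := by
  have hpt : ∀ x, ‖wit t x‖ ^ 2 ≤ 1 := fun x => by
    calc ‖wit t x‖ ^ 2 ≤ Real.exp t * gauss x := norm_wit_sq_le t x
      _ ≤ 1 * 1 := mul_le_mul (Real.exp_le_one_iff.2 ht) (gauss_le_one x) (gauss_pos x).le zero_le_one
      _ = 1 := one_mul _
  have hfin : volume (Metric.ball x₀ r) ≠ ⊤ := measure_ball_lt_top.ne
  calc ∫ x in Metric.ball x₀ r, ‖wit t x‖ ^ 2 ≤ ∫ x in Metric.ball x₀ r, (1 : ℝ) :=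
        integral_mono_of_nonneg (Filter.Eventually.of_forall fun x => by positivity)
          (integrableOn_const hfin) (Filter.Eventually.of_forall hpt)
    _ = r ^ 3 * V1 := by rw [setIntegral_const, smul_eq_mul, mul_one, measureReal_def, volume_ball_toReal x₀ hr]

/-- Gradient energy on a ball: `∫_B ‖∇wit t‖² ≤ 16 e^{t} IG`. -/
theorem setIntegral_norm_fderiv_wit_sq_le (t : ℝ) (x₀ : (EuclideanSpace ℝ (Fin 3))) (r : ℝ) :
    ∫ x in Metric.ball x₀ r, ‖fderiv ℝ (wit t) x‖ ^ 2 ≤ Real.exp t * (16 * IG) := by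
  have hi : Integrable (fun x => Real.exp t * (16 * gauss x)) := (integrable_gauss.const_mul _).const_mul _
  calc ∫ x in Metric.ball x₀ r, ‖fderiv ℝ (wit t) x‖ ^ 2
      ≤ ∫ x in Metric.ball x₀ r, Real.exp t * (16 * gauss x) :=
        integral_mono_of_nonneg (Filter.Eventually.of_forall fun x => by positivity) hi.integrableOn
          (Filter.Eventually.of_forall fun x => norm_fderiv_wit_sq_le t x)
    _ ≤ ∫ x, Real.exp t * (16 * gauss x) :=
        setIntegral_le_integral hi (Filter.Eventually.of_forall fun x => by
          have := gauss_pos x; positivity)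
    _ = Real.exp t * (16 * IG) := by rw [integral_const_mul, integral_const_mul, IG]

/-- `∫_{(t₀−r², t₀)} e^{t} dt = e^{t₀} − e^{t₀−r²} ≤ min(1, r²)` for `t₀ ≤ 0`. -/
theorem setIntegral_exp_Ioo_le {t₀ r : ℝ} (ht₀ : t₀ ≤ 0) :
    ∫ t in Set.Ioo (t₀ - r ^ 2) t₀, Real.exp t ≤ min 1 (r ^ 2) := by
  have hle : t₀ - r ^ 2 ≤ t₀ := by nlinarith [sq_nonneg r]
  have h : ∫ t in Set.Ioo (t₀ - r ^ 2) t₀, Real.exp t = Real.exp t₀ - Real.exp (t₀ - r ^ 2) := by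
    rw [← integral_Ioc_eq_integral_Ioo, ← intervalIntegral.integral_of_le hle, integral_exp]
  rw [h]
  refine le_min ?_ ?_
  · have h1 : Real.exp t₀ ≤ 1 := Real.exp_le_one_iff.2 ht₀
    have h2 : 0 < Real.exp (t₀ - r ^ 2) := Real.exp_pos _
    linarith
  · have h1 : Real.exp (t₀ - r ^ 2) = Real.exp t₀ * Real.exp (-r ^ 2) := by rw [← Real.exp_add]; ring_nf
    have h2 : -r ^ 2 + 1 ≤ Real.exp (-r ^ 2) := Real.add_one_le_exp _
    have h3 : Real.exp t₀ ≤ 1 := Real.exp_le_one_iff.2 ht₀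
    have h4 : 0 < Real.exp t₀ := Real.exp_pos _
    rw [h1]
    nlinarith


end Summit.NavierStokesRegularity.NavierStokesRegularity.Theorems.MustSqueeze.Negative
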